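import Summits.BirchSwinnertonDyer.BirchSwinnertonDyer.Theorems.CumulativeHeegnerLeopoldtRedSplitControlAtThreeOfPoitouTateTotallyComplex
import Summits.BirchSwinnertonDyer.BirchSwinnertonDyer.Theorems.CumulativeHeegnerLeopoldtRedSplitControlAtThreeShaTwoOfR4
import Summits.BirchSwinnertonDyer.BirchSwinnertonDyer.Theorems.SchneiderFreeAdditiveX3PoitouTateSelmerDualityHolds
import HarnessLib

/-!
# Crux K4 `RedSplitControlAtThree` (stmt-BirchSwinnertonDyer-24200) BY NAME modulo ONE displayed hypothesis:
# the E-side reciprocity identity (R4) at the totally complex number fields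

Seat `bsd-line-chl-p2` g7 (cell `bsd-wall`; `--supports stmt-BirchSwinnertonDyer-24200`, helper; CONDITIONAL).  Composition of
* `RedSplitControlAtThreeOfFacts.redSplitControlAtThree_of_poitouTate_totallyComplex` (g5): K4 ⟸ PT1 ∧ PT2 at the totally
  complex number fields;
* PT1 := `PoitouTateReduction.poitouTate_selmerStructure_duality_holds K` (cell bsd-schneider, door-c4 g18: Milne I 4.10 (b) for
  THE canonical local invariant maps, every number field);
* PT2 := `PoitouTateShaTwoReadout.poitouTate_sha_tateDual_of_R4` (this seat: (A) Brauer–Hasse–Noether over `K(M)`; door-c5's (B),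
  idèle projections, (R3); door-c4's `SelmerComplement` and Tate duality for `C̄`) — PT2 at a totally complex `K` from (R4) alone.

**`redSplitControlAtThree_of_R4`** — the TYPE of its conclusion is the route decl
`Summit.BirchSwinnertonDyer.BirchSwinnertonDyer.Theses.CumulativeHeegnerLeopoldt.RedSplitControlAtThree` verbatim; its one
hypothesis is (R4) (the E-side reciprocity identity in equality form with a bijective bridge `nat`, door-c4 lane of cell
bsd-schneider), quantified over the totally complex number fields.

HONEST FRAMING: CONDITIONAL on (R4); closes no item by itself; BSD is not proved here; Poitou–Tate (a) is not proved outright.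

References: [MilneADT2006] I Thm. 4.10 and its proof (p. 58), Lemma 4.13; [PerrinRiou1987] §1.
-/

noncomputable section

open Function NumberField IsDedekindDomain CategoryTheory CategoryTheory.Abelian Field
open scoped NumberField ContRepresentation

-- `Summit.<P>.<Sub>` repeats `BirchSwinnertonDyer` by the tree's layout convention (D-0017)
set_option linter.dupNamespace false

namespace Summit.BirchSwinnertonDyer.BirchSwinnertonDyer.Theorems.RedSplitControlAtThreeOfFacts

open Literature.NumberTheory.GaloisRepresentations Literature.NumberTheory.GaloisCohomology
open Literature.NumberTheory.GaloisRepresentations.DiscreteGaloisModule (TateDual tateDual unramifiedSubgroup localTatePairingZMod)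
open Literature.Algebra.Homology Literature.Algebra.Homology.DiscreteRep Literature.Algebra.Homology.ExtPresentation
open Literature.NumberTheory.GaloisRepresentations.IdeleClassBar (classBarD classBarInv)
open Literature.AnabelianGeometry.AbsoluteAnabelian.Prop121vii (zmodToQmodZ)
open Literature.NumberTheory.GaloisRepresentations.FreePresentation (presentationComplex presentationComplex_shortExact)
open Literature.NumberTheory.GaloisRepresentations.HomDual (readout)
open Literature.NumberTheory.GaloisRepresentations.IdeleReadout (ideleProjection)
open Summit.BirchSwinnertonDyer.BirchSwinnertonDyer.Theorems.SchneiderFreeAdditiveX3.PoitouTateReduction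
  (poitouTate_selmerStructure_duality_holds)
open Summit.BirchSwinnertonDyer.BirchSwinnertonDyer.Theorems.PoitouTateShaTwoReadout (poitouTate_sha_tateDual_of_R4)

/-- **K4 `RedSplitControlAtThree` BY NAME from the reciprocity identity (R4) at the totally complex number fields ALONE.**
PT1 (`poitouTate_selmerStructure_duality`) is door-c4 g18's theorem for every number field; PT2 (`poitouTate_sha_tateDual`)
at a totally complex field follows from (R4) (`poitouTate_sha_tateDual_of_R4`); the K1 door consumes both only at the
imaginary quadratic Heegner field.  CONDITIONAL on (R4); closes nothing by itself.
[cite: MilneADT2006, Ch. I, Thm. 4.10 (proof, p. 58), Lemma 4.13][cite: PerrinRiou1987, §1] -/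
theorem redSplitControlAtThree_of_R4
    (hR4 : ∀ (K : Type) [Field K] [NumberField K] [IsTotallyComplex K] (n : ℕ) [NeZero n],
      ∀ ⦃M : Type⦄ [AddCommGroup M] [TopologicalSpace M] [DiscreteTopology M] [Finite M] [Finite (TateDual K M n)]
      (ρ₀ : DiscreteGaloisModule K M) (hM : ∀ m : M, n • m = 0),
      ∃ nat : galoisCohomology ((ρ₀.tateDual n).tateDual n) 1 →+
          Abelian.Ext (triv (Γ := absoluteGaloisGroup K) ℤ) (presentationComplex ρ₀).X₃ 1,
        Function.Bijective nat ∧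
        ∀ f : (presentationComplex ρ₀).X₁ ⟶ (ideleClassLimitShortComplex K).X₂, ∃ Tf : Finset (Place K),
          ∀ (y : galoisCohomology ((ρ₀.tateDual n).tateDual n) 1) (T' : Finset (Place K)), Tf ⊆ T' →
            (∀ v : HeightOneSpectrum (𝓞 K), (Sum.inr v : Place K) ∉ T' →
              galoisCohomology.localization ((ρ₀.tateDual n).tateDual n) (Sum.inr v) 1 y ∈
                unramifiedSubgroup (GaloisRep.toLocal v ((ρ₀.tateDual n).tateDual n)) 1) →
            zmodToQmodZ n (∑ v ∈ T', localTatePairingZMod (ρ₀.tateDual n) n v (LocalInvariants.canonical K n v)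
              (readout ρ₀ n hM (ideleProjection K v) f)
              (galoisCohomology.localization ((ρ₀.tateDual n).tateDual n) v 1 y)) =
            classBarInv K ((nat y).comp (boundary (presentationComplex_shortExact ρ₀) (classBarD K)
              (f ≫ (ideleClassLimitShortComplex K).g)) (rfl : 1 + 1 = 2))) :
    Summit.BirchSwinnertonDyer.BirchSwinnertonDyer.Theses.CumulativeHeegnerLeopoldt.RedSplitControlAtThree :=
  redSplitControlAtThree_of_poitouTate_totallyComplex (fun K _ _ _ => poitouTate_selmerStructure_duality_holds K)
    (fun K _ _ _ => poitouTate_sha_tateDual_of_R4 (fun n _ => hR4 K n))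

end Summit.BirchSwinnertonDyer.BirchSwinnertonDyer.Theorems.RedSplitControlAtThreeOfFacts

end
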